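import Mathlib
import HarnessLib
import Summits.QuantumAdvantage.QuantumAdvantage.Theorems.PumpDialC

/-!
# PumpDial, part D (sections Degree, LiveArith, Calculus) — support for item stmt-QuantumAdvantage-28487

Cell decomp-qadv, seat lens-4 («minimal counterexample / extremal reduction»), generation 25 — land port of the node
«PumpDial» (published under the cell's HOME/decomp-qadv-lens-4/g25/PumpDial.lean rev 3, sha256 59c460875773e61d…, record NODE-g25.md;
RESIDUAL MODE on AbsorptionDial:28487 `NoPerfectPolyOdd`).  The node file with ONLY the namespace renamed
`Theses.PumpDial → Theorems.PumpDial`, `example`s dropped and one-line docstrings added where missing, cut into chain-imported parts;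
the X-side junction theorems (conclusion `AbsorptionDial.NoPerfectPolyOdd` BY NAME) live in the LAST part, the only one importing
`Theses.AbsorptionDial`; every other part imports only `AdviceFreeQNC0.*`, `Literature.Computability.MetaComplexity.*`, HarnessLib, Mathlib
(no import path to any Theses file — checked on the tree's import lines), so route items can be typed BY NAME over these parts.
No `sorry`, no new axioms, no instances, no notation.

This part: `mono_sub_sign_cpl_mem` … `unityAt_parity_diag` (25 declarations).
-/

set_option autoImplicit false
set_option linter.dupNamespace false

noncomputable section

namespace Summit.QuantumAdvantage.QuantumAdvantage.Theorems.PumpDial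
open Classical
open Finset
open Summit.QuantumAdvantage.AdviceFreeQNC0
open Summit.QuantumAdvantage.AdviceFreeQNC0.TwoShot
open Summit.QuantumAdvantage.AdviceFreeQNC0.CharK
open Literature.Computability.MetaComplexity Literature.Computability.MetaComplexity.Smolensky

section Degree

variable {K : Type*} [Field K] {n : ℕ}

/-- **parity lemma for monomials**: `x_S − (−1)^{|S|}·(x_S ∘ ¬)` has degree `< |S|` (the top monomial cancels). -/
theorem mono_sub_sign_cpl_mem (S : Finset (Fin n)) :
    mono K S - ((-1 : K) ^ S.card) • cpl (mono K S) ∈ lowDeg K n (S.card - 1) := by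
  induction S using Finset.induction_on with
  | empty =>
    have e : mono K (∅ : Finset (Fin n)) - ((-1 : K) ^ (∅ : Finset (Fin n)).card) • cpl (mono K ∅) = 0 := by
      funext u; simp [cpl_apply]
    rw [e]; exact Submodule.zero_mem _
  | insert a T ha ih =>
    rw [Finset.card_insert_of_notMem ha, Finset.insert_eq, ← mono_mul, cpl_mul, cpl_mono_singleton, pow_succ]
    by_cases hT : T = ∅
    · subst hT
      have e : mono K {a} * mono K (∅ : Finset (Fin n)) -
          ((-1 : K) ^ (∅ : Finset (Fin n)).card * -1) • ((1 - mono K {a}) * cpl (mono K ∅)) = fun _ => (1 : K) := by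
        funext u; simp [mono, cpl_apply, Finset.prod_singleton]
      rw [e]; exact const_mem_lowDeg 1 _
    · have hT1 : 1 ≤ T.card := Finset.card_pos.2 (Finset.nonempty_iff_ne_empty.2 hT)
      have e : mono K {a} * mono K T - ((-1 : K) ^ T.card * -1) • ((1 - mono K {a}) * cpl (mono K T)) =
          mono K {a} * (mono K T - ((-1 : K) ^ T.card) • cpl (mono K T)) + ((-1 : K) ^ T.card) • cpl (mono K T) := by
        funext u
        simp only [Pi.sub_apply, Pi.mul_apply, Pi.add_apply, Pi.smul_apply, Pi.one_apply, smul_eq_mul]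
        ring
      rw [e, show T.card + 1 - 1 = 1 + (T.card - 1) by omega]
      refine Submodule.add_mem _ (mul_mem_lowDeg_add (mono_mem_lowDeg (by simp)) ih) ?_
      exact Submodule.smul_mem _ _ (lowDeg_mono (by omega) (cpl_mem_lowDeg (mono_mem_lowDeg le_rfl)))

/-- **even part drops an odd degree**: for `P` of degree `≤ 2e+1`, `P + P∘¬` has degree `≤ 2e`. -/
theorem add_cpl_mem_lowDeg {e : ℕ} {P : CubeFn K n} (hP : P ∈ lowDeg K n (2 * e + 1)) :
    P + cpl P ∈ lowDeg K n (2 * e) := by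
  rw [lowDeg_eq_span] at hP
  induction hP using Submodule.span_induction with
  | mem Q hQ =>
    obtain ⟨⟨S, hS⟩, rfl⟩ := hQ
    dsimp only
    rcases Nat.lt_or_ge S.card (2 * e + 1) with hlt | hge
    · exact Submodule.add_mem _ (mono_mem_lowDeg (by omega)) (cpl_mem_lowDeg (mono_mem_lowDeg (by omega)))
    · have hcard : S.card = 2 * e + 1 := le_antisymm hS hge
      have hsign : ((-1 : K) ^ S.card) = -1 := by
        rw [hcard, pow_succ, pow_mul]; simp
      have h := mono_sub_sign_cpl_mem (K := K) S
      rw [hsign, neg_one_smul, sub_neg_eq_add, hcard, Nat.add_sub_cancel] at h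
      exact h
  | zero => rw [cpl_zero, add_zero]; exact Submodule.zero_mem _
  | add Q R _ _ hQ hR =>
    have e : Q + R + cpl (Q + R) = (Q + cpl Q) + (R + cpl R) := by rw [cpl_add]; abel
    rw [e]; exact Submodule.add_mem _ hQ hR
  | smul a Q _ hQ =>
    have e : a • Q + cpl (a • Q) = a • (Q + cpl Q) := by rw [cpl_smul, smul_add]
    rw [e]; exact Submodule.smul_mem _ a hQ

end Degree

section LiveArith

variable {K : Type*} [Field K] {n : ℕ}

/-! ## §9 Liveness arithmetic -/

/-- `wt_lt_succ` (PumpDial g25, section LiveArith; the node's `wt_le` restated as a strict bound — the tree's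
homonymous `AdviceFreeQNC0.wt_le_dim` is about `Hegedus.wt`, a different function, so it cannot be cited here). -/
theorem wt_lt_succ (u : Fin n → Bool) : wt u < n + 1 := by
  have h := wt_not (fun i => !u i)
  simp only [Bool.not_not] at h
  change wt u = _ at h
  omega


/-- `wtPrefix_le` (PumpDial g25, section LiveArith). -/
theorem wtPrefix_le (u : Fin n → Bool) {g : ℕ} (hg : g ≤ n) : wtPrefix u g ≤ g := by
  have h := wtPrefix_not (fun i => !u i) hg
  simp only [Bool.not_not] at h
  change wtPrefix u g = _ at h
  omega

/-- the game depends on the charge mod `3` only. -/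
theorem liveInd_charge_mod {c c' : ℕ} (h : c % 3 = c' % 3) (g : Fin (n + 1)) :
    liveInd K c g = liveInd (n := n) K c' g := by
  funext u; unfold liveInd
  exact if_congr (by constructor <;> intro h1 <;> omega) rfl rfl

/-- `unityAt_charge_mod` (PumpDial g25, section LiveArith). -/
theorem unityAt_charge_mod {c c' d : ℕ} (h : c % 3 = c' % 3) (hU : UnityAt K n c d) : UnityAt K n c' d := by
  obtain ⟨Y, hY, h1⟩ := hU
  refine ⟨Y, hY, fun u => ?_⟩
  rw [← h1 u]
  exact Finset.sum_congr rfl fun g _ => by rw [liveInd_charge_mod h]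

/-- RESTRICTION ARITHMETIC: cut `h+1` of the long board `(n+1, c)` at input `b :: v` is cut `h` of the short board
`(n, c+1+2b)` at `v` (tree `walkExp_cons_succ`). -/
theorem liveInd_succ_cons (c : ℕ) (b : Bool) (h : Fin (n + 1)) (v : Fin n → Bool) :
    liveInd K c h.succ (Fin.cons b v) = liveInd K (c + 1 + 2 * b.toNat) h v := by
  unfold liveInd
  refine if_congr ?_ rfl rfl
  rw [Fin.val_succ, walkExp_cons_succ]
  constructor <;> intro h1 <;> omega

/-- the PHANTOM (cut `0` of the long board on the half `b`) on a DIAGONAL long board (`c ≡ n+1`) has exactly the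
liveness of the LAST cut of the short board `(n, c+1+2b)`. -/
theorem liveInd_zero_cons_diag {c : ℕ} (hc : c % 3 = (n + 1) % 3) (b : Bool) (v : Fin n → Bool) :
    liveInd K c (0 : Fin (n + 2)) (Fin.cons b v) = liveInd K (c + 1 + 2 * b.toNat) (Fin.last n) v := by
  unfold liveInd
  refine if_congr ?_ rfl rfl
  rw [Fin.val_zero, Fin.val_last, walkExp_cons_zero, walkExp_at_last]
  cases b <;> simp only [Bool.toNat_false, Bool.toNat_true] <;> constructor <;> intro h1 <;> omega

/-- two-bit restriction, phantom `0`: with `b₀ + b₁ = 1`, cut `0` of `(n+2, c)` at `b₀ :: b₁ :: v` has the liveness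
of cut `0` of `(n, c+1)` at `v`. -/
theorem liveInd_zero_cons_cons {c : ℕ} (b₀ b₁ : Bool) (hb : b₀.toNat + b₁.toNat = 1) (v : Fin n → Bool) :
    liveInd K c (0 : Fin (n + 3)) (Fin.cons b₀ (Fin.cons b₁ v)) = liveInd K (c + 1) (0 : Fin (n + 1)) v := by
  unfold liveInd
  refine if_congr ?_ rfl rfl
  rw [Fin.val_zero, Fin.val_zero, walkExp_cons_zero, wt_cons, Summit.QuantumAdvantage.AdviceFreeQNC0.RigidityLaws.walkExp_zero]
  constructor <;> intro h1 <;> omega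

/-- two-bit restriction, phantom `1`: with `b₀ + b₁ = 1` and `c + b₁ ≡ n + 1`, cut `1` of `(n+2, c)` at
`b₀ :: b₁ :: v` has the liveness of the LAST cut of `(n, c+1)` at `v`. -/
theorem liveInd_one_cons_cons {c : ℕ} (b₀ b₁ : Bool) (hb : b₀.toNat + b₁.toNat = 1)
    (hc : (c + b₁.toNat) % 3 = (n + 1) % 3) (v : Fin n → Bool) :
    liveInd K c ((0 : Fin (n + 2)).succ) (Fin.cons b₀ (Fin.cons b₁ v)) = liveInd K (c + 1) (Fin.last n) v := by
  rw [liveInd_succ_cons]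
  unfold liveInd
  refine if_congr ?_ rfl rfl
  rw [Fin.val_zero, Fin.val_last, walkExp_cons_zero, walkExp_at_last]
  cases b₀ <;> cases b₁ <;> simp only [Bool.toNat_false, Bool.toNat_true] at hb hc ⊢ <;>
    constructor <;> intro h1 <;> omega

/-- on a DIAGONAL board (`c ≡ n`) complementing the input preserves every cut's liveness
(`a_g(¬u) ≡ −a_g(u)`; tree `wt_not`, `wtPrefix_not`). -/
theorem liveInd_cpl_diag {c : ℕ} (hc : c % 3 = n % 3) (g : Fin (n + 1)) (u : Fin n → Bool) :
    liveInd K c g (fun i => !(u i)) = liveInd K c g u := by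
  unfold liveInd
  refine if_congr ?_ rfl rfl
  have hg : g.val ≤ n := Nat.lt_succ_iff.1 g.isLt
  unfold walkExp
  rw [wt_not, wtPrefix_not u hg]
  have h1 : wt u ≤ n := Nat.lt_succ_iff.mp (wt_lt_succ u)
  have h2 := wtPrefix_le u hg
  constructor <;> intro h3 <;> omega

end LiveArith

section Calculus

variable {K : Type*} [Field K] {n : ℕ}

/-! ## §10 UNITY BOARD CALCULUS (PROVED): restriction, gluing, two-bit restriction, parity -/

/-- **RESTRICTION LAW (diagonal long board)**: a unity of degree `d` on `(n+1, c)` with `c ≡ n+1` restricts, on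
either half `b`, to a unity of degree `d` on `(n, c+1+2b)` — the phantom cut `0` is absorbed into the short board's
LAST cut, whose liveness it shares (`liveInd_zero_cons_diag`).  Both `(n, c+1)` and `(n, c+3) = (n, c)` follow. -/
theorem unityAt_restrict_diag {c d : ℕ} (hc : c % 3 = (n + 1) % 3) (hU : UnityAt K (n + 1) c d) (b : Bool) :
    UnityAt K n (c + 1 + 2 * b.toNat) d := by
  obtain ⟨Y, hY, h1⟩ := hU
  refine ⟨fun h => (fun v => Y h.succ (Fin.cons b v)) +
      (if h = Fin.last n then (fun v => Y 0 (Fin.cons b v)) else (0 : CubeFn K n)),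
    fun h => Submodule.add_mem _ (cons_comp_mem_lowDeg b (hY h.succ)) ?_, fun v => ?_⟩
  · by_cases hh : h = Fin.last n
    · rw [if_pos hh]; exact cons_comp_mem_lowDeg b (hY 0)
    · rw [if_neg hh]; exact Submodule.zero_mem _
  · have key := h1 (Fin.cons b v)
    rw [Fin.sum_univ_succ] at key
    have hA : (∑ h : Fin (n + 1), Y h.succ (Fin.cons b v) * liveInd K (c + 1 + 2 * b.toNat) h v) =
        ∑ h : Fin (n + 1), Y h.succ (Fin.cons b v) * liveInd K c h.succ (Fin.cons b v) :=
      Finset.sum_congr rfl fun h _ => by rw [liveInd_succ_cons]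
    have hB : (∑ h : Fin (n + 1), (if h = Fin.last n then (fun v => Y 0 (Fin.cons b v)) else (0 : CubeFn K n)) v *
        liveInd K (c + 1 + 2 * b.toNat) h v) = Y 0 (Fin.cons b v) * liveInd K c 0 (Fin.cons b v) := by
      rw [Finset.sum_eq_single (Fin.last n)]
      · rw [if_pos rfl, liveInd_zero_cons_diag hc]
      · intro h _ hh; rw [if_neg hh, Pi.zero_apply, zero_mul]
      · intro h; exact absurd (Finset.mem_univ _) h
    calc (∑ h : Fin (n + 1), ((fun v => Y h.succ (Fin.cons b v)) +
            (if h = Fin.last n then (fun v => Y 0 (Fin.cons b v)) else (0 : CubeFn K n))) v *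
            liveInd K (c + 1 + 2 * b.toNat) h v)
        = (∑ h : Fin (n + 1), Y h.succ (Fin.cons b v) * liveInd K (c + 1 + 2 * b.toNat) h v) +
          ∑ h : Fin (n + 1), (if h = Fin.last n then (fun v => Y 0 (Fin.cons b v)) else (0 : CubeFn K n)) v *
            liveInd K (c + 1 + 2 * b.toNat) h v := by
          rw [← Finset.sum_add_distrib]
          exact Finset.sum_congr rfl fun h _ => by rw [Pi.add_apply, add_mul]
      _ = 1 := by rw [hA, hB, add_comm]; exact key

/-- corollary: both short boards `(n, c+1)` and `(n, c)` inherit the unity at the same degree. -/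
theorem unityAt_restrict_diag' {c d : ℕ} (hc : c % 3 = (n + 1) % 3) (hU : UnityAt K (n + 1) c d) :
    UnityAt K n (c + 1) d ∧ UnityAt K n c d :=
  ⟨unityAt_restrict_diag hc hU false,
   unityAt_charge_mod (by simp only [Bool.toNat_true]; omega) (unityAt_restrict_diag hc hU true)⟩

/-- the glued cut functions: cut `0` silent; cut `h+1` plays `Y1 h` on the `1`-half and `Y0 h` on the `0`-half. -/
def glueY (Y0 Y1 : Fin (n + 1) → CubeFn K n) : Fin (n + 2) → CubeFn K (n + 1) :=
  Fin.cases (0 : CubeFn K (n + 1)) fun h u => if u 0 = true then Y1 h (Fin.tail u) else Y0 h (Fin.tail u)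

/-- `glueY_zero` (PumpDial g25, section Calculus). -/
theorem glueY_zero (Y0 Y1 : Fin (n + 1) → CubeFn K n) : glueY Y0 Y1 0 = 0 := by
  simp [glueY]

/-- `glueY_succ` (PumpDial g25, section Calculus). -/
theorem glueY_succ (Y0 Y1 : Fin (n + 1) → CubeFn K n) (h : Fin (n + 1)) (u : Fin (n + 1) → Bool) :
    glueY Y0 Y1 h.succ u = if u 0 = true then Y1 h (Fin.tail u) else Y0 h (Fin.tail u) := by
  simp [glueY]

/-- `glueY_succ_eq` (PumpDial g25, section Calculus). -/
theorem glueY_succ_eq (Y0 Y1 : Fin (n + 1) → CubeFn K n) (h : Fin (n + 1)) :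
    glueY Y0 Y1 h.succ = (fun u : Fin (n + 1) → Bool => if u 0 = true then (1 : K) else 0) *
        (fun u => Y1 h (Fin.tail u)) +
      (fun u : Fin (n + 1) → Bool => 1 - (if u 0 = true then (1 : K) else 0)) * (fun u => Y0 h (Fin.tail u)) := by
  funext u
  rw [glueY_succ]
  simp only [Pi.add_apply, Pi.mul_apply]
  rcases Bool.eq_false_or_eq_true (u 0) with hb | hb <;> simp [hb]

/-- `glueY_mem_lowDeg` (PumpDial g25, section Calculus). -/
theorem glueY_mem_lowDeg {d : ℕ} {Y0 Y1 : Fin (n + 1) → CubeFn K n} (h0 : ∀ h, Y0 h ∈ lowDeg K n d)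
    (h1 : ∀ h, Y1 h ∈ lowDeg K n d) (g : Fin (n + 2)) : glueY Y0 Y1 g ∈ lowDeg K (n + 1) (d + 1) := by
  refine Fin.cases ?_ (fun h => ?_) g
  · rw [glueY_zero]; exact Submodule.zero_mem _
  · rw [glueY_succ_eq, add_comm d 1]
    exact Submodule.add_mem _ (mul_mem_lowDeg_add (indicator_mem_lowDeg_one 0) (tail_comp_mem_lowDeg (h1 h)))
      (mul_mem_lowDeg_add (one_sub_indicator_mem_lowDeg_one 0) (tail_comp_mem_lowDeg (h0 h)))

/-- **GLUING LAW (all boards)**: unities of degree `d` on `(n, c+1)` and `(n, c)` glue (first bit `0 ↦` the former,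
`1 ↦` the latter, cut `0` silent) to a unity of degree `d+1` on `(n+1, c)`. -/
theorem unityAt_glue {c d : ℕ} (h0 : UnityAt K n (c + 1) d) (h1 : UnityAt K n c d) :
    UnityAt K (n + 1) c (d + 1) := by
  obtain ⟨Y0, hY0, h0'⟩ := h0
  obtain ⟨Y1, hY1, h1'⟩ := h1
  refine ⟨glueY Y0 Y1, glueY_mem_lowDeg hY0 hY1, fun u => ?_⟩
  rw [← Fin.cons_self_tail u, Fin.sum_univ_succ, glueY_zero, Pi.zero_apply, zero_mul, zero_add]
  have e : ∀ h : Fin (n + 1), glueY Y0 Y1 h.succ (Fin.cons (u 0) (Fin.tail u)) * liveInd K c h.succ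
      (Fin.cons (u 0) (Fin.tail u)) = (if u 0 = true then Y1 h (Fin.tail u) else Y0 h (Fin.tail u)) *
      liveInd K (c + 1 + 2 * (u 0).toNat) h (Fin.tail u) := fun h => by
    rw [glueY_succ, liveInd_succ_cons, Fin.cons_zero, Fin.tail_cons]
  rw [Finset.sum_congr rfl fun h _ => e h]
  rcases Bool.eq_false_or_eq_true (u 0) with hb | hb
  · simp only [hb, if_true, Bool.toNat_true, mul_one]
    rw [← h1' (Fin.tail u)]
    exact Finset.sum_congr rfl fun h _ => by rw [liveInd_charge_mod (c' := c) (by omega)]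
  · simp only [hb, Bool.false_eq_true, if_false, Bool.toNat_false, mul_zero, add_zero]
    exact h0' (Fin.tail u)

/-- **TWO-BIT RESTRICTION LAW (off-diagonal boards)**: a unity of degree `d` on `(n+2, c)` restricts to one of
degree `d` on `(n, c+1)` along the two-bit prefix `(b₀, b₁)` with `b₀ + b₁ = 1`, `c + b₁ ≡ n+1`: phantom `0` is
absorbed by the short cut `0` and phantom `1` by the short LAST cut.  (`c ≡ n+1`: prefix `10`; `c ≡ n`: prefix
`01`; both boards off-diagonal of the same parity.)  The one-bit off-diagonal restriction FAILS for unities (the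
Boolean XOR trick `𝟙[ph] ≡ 𝟙[0] + 𝟙[n] (mod 2)` has no K-linear analogue). -/
theorem unityAt_restrict_two {c d : ℕ} (b₀ b₁ : Bool) (hb : b₀.toNat + b₁.toNat = 1)
    (hc : (c + b₁.toNat) % 3 = (n + 1) % 3) (hU : UnityAt K (n + 2) c d) : UnityAt K n (c + 1) d := by
  obtain ⟨Y, hY, h1⟩ := hU
  let w : (Fin n → Bool) → (Fin (n + 2) → Bool) := fun v => Fin.cons b₀ (Fin.cons b₁ v)
  have hw : ∀ {P : CubeFn K (n + 2)}, P ∈ lowDeg K (n + 2) d → (fun v => P (w v)) ∈ lowDeg K n d :=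
    fun hP => cons_comp_mem_lowDeg b₁ (cons_comp_mem_lowDeg b₀ hP)
  refine ⟨fun h => (fun v => Y h.succ.succ (w v)) + ((if h = 0 then (fun v => Y 0 (w v)) else (0 : CubeFn K n)) +
      (if h = Fin.last n then (fun v => Y (0 : Fin (n + 2)).succ (w v)) else (0 : CubeFn K n))),
    fun h => Submodule.add_mem _ (hw (hY _)) (Submodule.add_mem _ ?_ ?_), fun v => ?_⟩
  · by_cases hh : h = 0
    · rw [if_pos hh]; exact hw (hY 0)
    · rw [if_neg hh]; exact Submodule.zero_mem _
  · by_cases hh : h = Fin.last n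
    · rw [if_pos hh]; exact hw (hY _)
    · rw [if_neg hh]; exact Submodule.zero_mem _
  · have key := h1 (w v)
    rw [Fin.sum_univ_succ, Fin.sum_univ_succ] at key
    have hc2 : (c + 1 + 2 * b₀.toNat + 1 + 2 * b₁.toNat) % 3 = (c + 1) % 3 := by omega
    have hA : (∑ h : Fin (n + 1), Y h.succ.succ (w v) * liveInd K (c + 1) h v) =
        ∑ h : Fin (n + 1), Y h.succ.succ (w v) * liveInd K c h.succ.succ (w v) :=
      Finset.sum_congr rfl fun h _ => by
        rw [show w v = Fin.cons b₀ (Fin.cons b₁ v) from rfl, liveInd_succ_cons, liveInd_succ_cons,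
          liveInd_charge_mod hc2]
    have hB : (∑ h : Fin (n + 1), (if h = 0 then (fun v => Y 0 (w v)) else (0 : CubeFn K n)) v *
        liveInd K (c + 1) h v) = Y 0 (w v) * liveInd K c 0 (w v) := by
      rw [Finset.sum_eq_single (0 : Fin (n + 1))]
      · rw [if_pos rfl, show w v = Fin.cons b₀ (Fin.cons b₁ v) from rfl, liveInd_zero_cons_cons b₀ b₁ hb]
      · intro h _ hh; rw [if_neg hh, Pi.zero_apply, zero_mul]
      · intro h; exact absurd (Finset.mem_univ _) h
    have hC : (∑ h : Fin (n + 1), (if h = Fin.last n then (fun v => Y (0 : Fin (n + 2)).succ (w v))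
        else (0 : CubeFn K n)) v * liveInd K (c + 1) h v) =
        Y (0 : Fin (n + 2)).succ (w v) * liveInd K c (0 : Fin (n + 2)).succ (w v) := by
      rw [Finset.sum_eq_single (Fin.last n)]
      · rw [if_pos rfl, show w v = Fin.cons b₀ (Fin.cons b₁ v) from rfl, liveInd_one_cons_cons b₀ b₁ hb hc]
      · intro h _ hh; rw [if_neg hh, Pi.zero_apply, zero_mul]
      · intro h; exact absurd (Finset.mem_univ _) h
    calc (∑ h : Fin (n + 1), ((fun v => Y h.succ.succ (w v)) +
            ((if h = 0 then (fun v => Y 0 (w v)) else (0 : CubeFn K n)) +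
            (if h = Fin.last n then (fun v => Y (0 : Fin (n + 2)).succ (w v)) else (0 : CubeFn K n)))) v *
            liveInd K (c + 1) h v)
        = (∑ h : Fin (n + 1), Y h.succ.succ (w v) * liveInd K (c + 1) h v) +
          ((∑ h : Fin (n + 1), (if h = 0 then (fun v => Y 0 (w v)) else (0 : CubeFn K n)) v * liveInd K (c + 1) h v)
          + ∑ h : Fin (n + 1), (if h = Fin.last n then (fun v => Y (0 : Fin (n + 2)).succ (w v))
              else (0 : CubeFn K n)) v * liveInd K (c + 1) h v) := by
          rw [← Finset.sum_add_distrib, ← Finset.sum_add_distrib]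
          exact Finset.sum_congr rfl fun h _ => by rw [Pi.add_apply, Pi.add_apply, add_mul, add_mul]
      _ = 1 := by
          rw [hA, hB, hC, ← key]; ring

/-- the two off-diagonal instances spelled out: prefix `10` when `c ≡ n+1`, prefix `01` when `c ≡ n`. -/
theorem unityAt_restrict_two_A {c d : ℕ} (hc : c % 3 = (n + 1) % 3) (hU : UnityAt K (n + 2) c d) :
    UnityAt K n (c + 1) d :=
  unityAt_restrict_two true false (by simp) (by simpa using hc) hU

/-- `unityAt_restrict_two_B` (PumpDial g25, section Calculus). -/
theorem unityAt_restrict_two_B {c d : ℕ} (hc : c % 3 = n % 3) (hU : UnityAt K (n + 2) c d) :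
    UnityAt K n (c + 1) d :=
  unityAt_restrict_two false true (by simp) (by simp only [Bool.toNat_true]; omega) hU

/-- **CHARGE DUALITY for unities**: complementing the input maps `(n, c)` onto `(n, c'')` with `c + c'' + n ≡ 0`. -/
theorem liveInd_cpl {c c'' : ℕ} (hcc : (c + c'' + n) % 3 = 0) (g : Fin (n + 1)) (u : Fin n → Bool) :
    liveInd K c'' g (fun i => !(u i)) = liveInd K c g u := by
  unfold liveInd
  refine if_congr ?_ rfl rfl
  have hg : g.val ≤ n := Nat.lt_succ_iff.1 g.isLt
  unfold walkExp
  rw [wt_not, wtPrefix_not u hg]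
  have h1 : wt u ≤ n := Nat.lt_succ_iff.mp (wt_lt_succ u)
  have h2 := wtPrefix_le u hg
  constructor <;> intro h3 <;> omega

/-- `unityAt_cpl` (PumpDial g25, section Calculus). -/
theorem unityAt_cpl {c c'' d : ℕ} (hcc : (c + c'' + n) % 3 = 0) (hU : UnityAt K n c d) : UnityAt K n c'' d := by
  obtain ⟨Y, hY, h1⟩ := hU
  refine ⟨fun g => cpl (Y g), fun g => cpl_mem_lowDeg (hY g), fun u => ?_⟩
  have key := h1 (fun i => !(u i))
  rw [← key]
  refine Finset.sum_congr rfl fun g _ => ?_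
  show cpl (Y g) u * liveInd K c'' g u = _
  rw [cpl_apply, liveInd_cpl (K := K) (c := c'') (c'' := c) (by omega) g u]

/-- **PARITY LAW (diagonal boards, `char K ≠ 2`)**: on `(n, c)` with `c ≡ n` the complement is a liveness symmetry
(`liveInd_cpl_diag`), so averaging a unity with its complement twin gives a unity — and the even part of a
degree-`(2e+1)` function has degree `2e` (`add_cpl_mem_lowDeg`).  Hence the least unity degree on a diagonal board is
EVEN. -/
theorem unityAt_parity_diag (h2 : (2 : K) ≠ 0) {c e : ℕ} (hc : c % 3 = n % 3)
    (hU : UnityAt K n c (2 * e + 1)) : UnityAt K n c (2 * e) := by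
  obtain ⟨Y, hY, h1⟩ := hU
  refine ⟨fun g => (2 : K)⁻¹ • (Y g + cpl (Y g)), fun g => Submodule.smul_mem _ _ (add_cpl_mem_lowDeg (hY g)),
    fun u => ?_⟩
  have k1 := h1 u
  have k2 : (∑ g, Y g (fun i => !(u i)) * liveInd K c g u) = 1 := by
    rw [← h1 (fun i => !(u i))]
    exact Finset.sum_congr rfl fun g _ => by rw [liveInd_cpl_diag hc]
  calc (∑ g, ((2 : K)⁻¹ • (Y g + cpl (Y g))) u * liveInd K c g u)
      = (2 : K)⁻¹ * ((∑ g, Y g u * liveInd K c g u) + ∑ g, Y g (fun i => !(u i)) * liveInd K c g u) := by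
        rw [← Finset.sum_add_distrib, Finset.mul_sum]
        exact Finset.sum_congr rfl fun g _ => by
          simp only [Pi.smul_apply, Pi.add_apply, cpl_apply, smul_eq_mul]; ring
    _ = 1 := by rw [k1, k2, show (1 : K) + 1 = 2 by norm_num]; exact inv_mul_cancel₀ h2

end Calculus

end Summit.QuantumAdvantage.QuantumAdvantage.Theorems.PumpDial
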